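import Summits.FinalStateConjecture.FinalStateConjecture.Theorems.BartnikGapSettlingBondiBartnikRigidityMarchingLemmaKiteCauchy
import Literature.Geometry.Lorentzian.KerrStationaryBlackHole
import HarnessLib

/-!
# K2b-5 `stub_marchingLemma`, brick 3: the kite is an open, connected sub-spacetime; placement of its
# two halves — line `direct-method-on-the-cone` (crux `BondiBartnikRigidity`, stmt-FinalStateConjecture-10807)

Companion of `…MarchingLemmaKiteCauchy.lean` (the level slice `{t* = σ}` is a Cauchy hypersurface of the
KITE `K = K⁺ ∪ K⁻` over `Σ = {σ} × S` in the Kerr star chart).  Here, for the same membership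
predicates:

* `isOpen_kite` — `K` is open (`S`, `W` open, `{σ} × S ⊆ W`, `0 < h±`): at a point above the level the
  cone `closedBall x̂ (t* − σ) ∩ {r ≥ min (r(x), r₊)}` is the intersection of the decreasing compact
  family of its thickenings, one of which still lies in the open `S` (`exists_subset_nhds_of_isCompact'`);
  at a point of the level both halves are reached from a ball of `S`; below the level all clauses are open;
* `isConnected_kite` — `K` is connected when `S` is (and `W` is invariant under `+ u ∂_{t*}`, `u ≥ 0`):
  every point of `K` is joined to `Σ ≅ S` by its vertical segment inside `K`;
* `upper_subset_chronologicalFuture_kite` — inside the kite, `K ∩ {t* > σ} ⊆ I⁺_K(Σ)` (the endless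
  timelike curve through a point meets the Cauchy hypersurface, strictly before the point by the clock `t*`).

References: O'Neill 1983, Ch. 14, Def. 14.28, p. 415 [ONeill1983]; Hawking–Ellis 1973, §6.5
[HawkingEllis1973CUP].  No definitions, no named facts.
-/

noncomputable section

-- D-0017: single-problem summit, `Summit.<S>.<S>.…` by design (cf. lakefile `weak.linter.dupNamespace`).
set_option linter.dupNamespace false

open Set Filter Function Topology TopologicalSpace Metric
open Literature.Geometry.Lorentzian
open scoped Manifold ContDiff Topology

namespace Summit.FinalStateConjecture.FinalStateConjecture.Theorems.BondiBartnikRigidity.DirectMethod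

namespace KerrKite

open F1Route (strictMonoOn_time' self_lt_rPlus)

/-! ### Openness -/

section Open

variable {M a : ℝ} {S : Set E3} {W : Set (Kerr.region a M)} {σ hp hm : ℝ}

/-- The point of the chart at level `t'` over the spatial point of `y` (same radius, so in the chart).
[folklore] -/
theorem ofTimeSpace_spatial_mem_region (y : Kerr.region a M) (t' : ℝ) :
    E4.ofTimeSpace t' (E4.spatial (y : E4)) ∈ Kerr.region a M := by
  rw [Kerr.mem_region, Kerr.radius_eq_of_spatial_eq a (E4.spatial_ofTimeSpace t' _)]
  exact y.2

/-- **The kite is open.**  Hypotheses: `S` open with `{σ} × S` inside the open set `W`, `0 < h⁺`,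
`0 < h⁻`. [folklore] -/
theorem isOpen_kite (hhp : 0 < hp) (hhm : 0 < hm) (hS : IsOpen S) (hWo : IsOpen W)
    (hSliceW : ∀ y : Kerr.region a M, (y : E4) 0 = σ → E4.spatial (y : E4) ∈ S → y ∈ W) :
    IsOpen {y : Kerr.region a M |
      (σ ≤ (y : E4) 0 ∧ (y : E4) 0 < σ + hp ∧ ∀ z : E3, ‖z - E4.spatial (y : E4)‖ ≤ (y : E4) 0 - σ →
        min (Kerr.radius a (y : E4)) (Kerr.rPlus M a) ≤ Kerr.radius a (E4.ofTimeSpace 0 z) → z ∈ S) ∨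
      (y ∈ W ∧ σ - hm < (y : E4) 0 ∧ (y : E4) 0 < σ ∧
        σ + 2 / 3 * M < (y : E4) 0 + 2 / 3 * Kerr.radius a (y : E4) ∧
        ∀ z : E3, ‖z - E4.spatial (y : E4)‖ ≤ σ - (y : E4) 0 → z ∈ S)} := by
  have hct : Continuous fun y : Kerr.region a M => (y : E4) 0 :=
    (PiLp.continuous_apply 2 (fun _ : Fin 4 => ℝ) 0).comp continuous_subtype_val
  have hcr : Continuous fun y : Kerr.region a M => Kerr.radius a (y : E4) :=
    (Kerr.continuous_radius a).comp continuous_subtype_val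
  have hcs : Continuous fun y : Kerr.region a M => E4.spatial (y : E4) :=
    E4.spatial.continuous.comp continuous_subtype_val
  have hcrz : Continuous fun z : E3 => Kerr.radius a (E4.ofTimeSpace 0 z) :=
    (Kerr.continuous_radius a).comp (E4.continuous_ofTimeSpace 0)
  have hcf : Continuous fun y : Kerr.region a M => min (Kerr.radius a (y : E4)) (Kerr.rPlus M a) :=
    hcr.min continuous_const
  rw [isOpen_iff_mem_nhds]
  intro y₀ hy₀
  -- neighbourhoods on which the coordinates of `y` stay close to those of `y₀`
  have hnear : ∀ δ : ℝ, 0 < δ → ∀ᶠ y : Kerr.region a M in 𝓝 y₀, |(y : E4) 0 - (y₀ : E4) 0| < δ ∧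
      ‖E4.spatial (y : E4) - E4.spatial (y₀ : E4)‖ < δ ∧
      |min (Kerr.radius a (y : E4)) (Kerr.rPlus M a) - min (Kerr.radius a (y₀ : E4)) (Kerr.rPlus M a)| < δ := by
    intro δ hδ
    have h1 : Tendsto (fun y : Kerr.region a M => |(y : E4) 0 - (y₀ : E4) 0|) (𝓝 y₀) (𝓝 0) := by
      have := ((hct.sub (continuous_const (y := (y₀ : E4) 0))).abs).tendsto y₀
      simpa using this
    have h2 : Tendsto (fun y : Kerr.region a M => ‖E4.spatial (y : E4) - E4.spatial (y₀ : E4)‖) (𝓝 y₀) (𝓝 0) := by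
      have := ((hcs.sub (continuous_const (y := E4.spatial (y₀ : E4)))).norm).tendsto y₀
      simpa using this
    have h3 : Tendsto (fun y : Kerr.region a M => |min (Kerr.radius a (y : E4)) (Kerr.rPlus M a) -
        min (Kerr.radius a (y₀ : E4)) (Kerr.rPlus M a)|) (𝓝 y₀) (𝓝 0) := by
      have := ((hcf.sub (continuous_const (y := min (Kerr.radius a (y₀ : E4)) (Kerr.rPlus M a)))).abs).tendsto y₀
      simpa using this
    filter_upwards [h1.eventually_lt_const hδ, h2.eventually_lt_const hδ, h3.eventually_lt_const hδ]
      with y hy1 hy2 hy3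
    exact ⟨hy1, hy2, hy3⟩
  rcases hy₀ with ⟨h0, h1, hcone⟩ | ⟨hW₀, h0, h1, hcl, hball⟩
  · rcases h0.lt_or_eq with hlt | heq
    · /- above the level: the thickened cones `A_n` decrease to the cone of `y₀`, which lies in the open
        `S`, so some `A_n ⊆ S`; nearby cones lie in `A_n`. -/
      set t₀ := (y₀ : E4) 0 with ht₀
      set f₀ := min (Kerr.radius a (y₀ : E4)) (Kerr.rPlus M a) with hf₀
      set A : ℕ → Set E3 := fun n => closedBall (E4.spatial (y₀ : E4)) (t₀ - σ + 1 / (n + 1)) ∩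
        {z | f₀ - 1 / (n + 1) ≤ Kerr.radius a (E4.ofTimeSpace 0 z)} with hA
      have hAanti : ∀ m n : ℕ, m ≤ n → A n ⊆ A m := by
        intro m n hmn z hz
        have h' : (1 : ℝ) / (n + 1) ≤ 1 / (m + 1) :=
          one_div_le_one_div_of_le (by positivity) (by exact_mod_cast Nat.succ_le_succ hmn)
        exact ⟨closedBall_subset_closedBall (by linarith) hz.1, by
          have := hz.2; simp only [mem_setOf_eq] at this ⊢; linarith⟩
      have hdir : Directed (· ⊇ ·) A := fun m n => ⟨max m n, hAanti _ _ (le_max_left _ _), hAanti _ _ (le_max_right _ _)⟩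
      have hAcl : ∀ n, IsClosed (A n) := fun n => isClosed_closedBall.inter (isClosed_le continuous_const hcrz)
      have hAcpt : ∀ n, IsCompact (A n) := fun n => (isCompact_closedBall _ _).inter_right (isClosed_le continuous_const hcrz)
      have hinter : ∀ z ∈ ⋂ n, A n, S ∈ 𝓝 z := by
        intro z hz
        rw [mem_iInter] at hz
        refine hS.mem_nhds (hcone z ?_ ?_)
        · refine le_of_forall_pos_lt_add fun ε hε => ?_
          obtain ⟨n, hn⟩ := exists_nat_one_div_lt hε
          have := (hz n).1
          rw [mem_closedBall, dist_eq_norm] at this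
          linarith
        · refine le_of_forall_pos_lt_add fun ε hε => ?_
          obtain ⟨n, hn⟩ := exists_nat_one_div_lt hε
          have := (hz n).2
          simp only [mem_setOf_eq] at this
          linarith
      obtain ⟨n, hn⟩ := exists_subset_nhds_of_isCompact' hdir hAcpt hAcl hinter
      have hδ : (0 : ℝ) < 1 / (n + 1) := by positivity
      have hgap : 0 < t₀ - σ := sub_pos.2 hlt
      filter_upwards [hnear _ (lt_min (half_pos (half_pos hδ)) hgap),
        (hct.tendsto y₀).eventually_lt_const h1] with y hy hy1
      obtain ⟨hyt, hys, hyf⟩ := hy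
      have hyt' := (abs_sub_lt_iff.1 hyt)
      have hmin : |(y : E4) 0 - t₀| < 1 / (n + 1) / 2 / 2 ∧ |(y : E4) 0 - t₀| < t₀ - σ := lt_min_iff.1 hyt
      refine Or.inl ⟨?_, hy1, fun z hz hrz => hn ⟨?_, ?_⟩⟩
      · have := (abs_sub_lt_iff.1 hmin.2).2; linarith
      · rw [mem_closedBall, dist_eq_norm]
        have hys' : ‖E4.spatial (y : E4) - E4.spatial (y₀ : E4)‖ < 1 / (n + 1) / 2 / 2 := (lt_min_iff.1 hys).1
        calc ‖z - E4.spatial (y₀ : E4)‖ ≤ ‖z - E4.spatial (y : E4)‖ + ‖E4.spatial (y : E4) - E4.spatial (y₀ : E4)‖ :=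
              norm_sub_le_norm_sub_add_norm_sub _ _ _
          _ ≤ t₀ - σ + 1 / (n + 1) := by
              have := (abs_sub_lt_iff.1 hmin.1).1; linarith
      · simp only [mem_setOf_eq]
        have hyf' : |min (Kerr.radius a (y : E4)) (Kerr.rPlus M a) - f₀| < 1 / (n + 1) / 2 / 2 := (lt_min_iff.1 hyf).1
        have := (abs_sub_lt_iff.1 hyf').2
        linarith
    · /- on the level: a ball of `S` around `x̂₀` reaches both halves. -/
      have hx₀S : E4.spatial (y₀ : E4) ∈ S := hcone _ (by rw [sub_self, norm_zero, ← heq, sub_self])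
        (by rw [Kerr.radius_eq_of_spatial_eq a (E4.spatial_ofTimeSpace 0 _)]; exact min_le_left _ _)
      have hy₀W : y₀ ∈ W := hSliceW y₀ heq.symm hx₀S
      obtain ⟨ε, hε, hball⟩ := Metric.isOpen_iff.1 hS _ hx₀S
      have hrM : M < Kerr.radius a (y₀ : E4) := Kerr.lt_radius_of_mem_region y₀.2
      have hclock : σ + 2 / 3 * M < (y₀ : E4) 0 + 2 / 3 * Kerr.radius a (y₀ : E4) := by rw [← heq]; linarith
      filter_upwards [hnear _ (half_pos hε), hWo.mem_nhds hy₀W,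
        ((hct.add (hcr.const_mul (2 / 3))).tendsto y₀).eventually_const_lt hclock,
        (hct.tendsto y₀).eventually_lt_const (show (y₀ : E4) 0 < σ + hp by rw [← heq]; linarith),
        (hct.tendsto y₀).eventually_const_lt (show σ - hm < (y₀ : E4) 0 by rw [← heq]; linarith)]
        with y hy hyW hycl hy1 hy2
      obtain ⟨hyt, hys, -⟩ := hy
      have hzS : ∀ z : E3, ‖z - E4.spatial (y : E4)‖ < ε / 2 → z ∈ S := fun z hz => hball (by
        rw [mem_ball, dist_eq_norm]
        calc ‖z - E4.spatial (y₀ : E4)‖ ≤ ‖z - E4.spatial (y : E4)‖ + ‖E4.spatial (y : E4) - E4.spatial (y₀ : E4)‖ :=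
              norm_sub_le_norm_sub_add_norm_sub _ _ _
          _ < ε := by linarith)
      have hyt' := abs_sub_lt_iff.1 hyt
      rcases le_or_gt σ ((y : E4) 0) with hge | hlt'
      · exact Or.inl ⟨hge, hy1, fun z hz _ => hzS z (by rw [← heq] at hyt'; linarith [hyt'.1])⟩
      · exact Or.inr ⟨hyW, hy2, hlt', hycl, fun z hz => hzS z (by rw [← heq] at hyt'; linarith [hyt'.2])⟩
  · /- below the level: every clause is open; the ball condition by thickening the compact ball. -/
    set t₀ := (y₀ : E4) 0 with ht₀
    obtain ⟨δ, hδ, hthick⟩ := (isCompact_closedBall (E4.spatial (y₀ : E4)) (σ - t₀)).exists_cthickening_subset_open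
      hS (fun z hz => hball z (by rw [mem_closedBall, dist_eq_norm] at hz; exact hz))
    filter_upwards [hnear _ (half_pos hδ), hWo.mem_nhds hW₀,
      ((hct.add (hcr.const_mul (2 / 3))).tendsto y₀).eventually_const_lt hcl,
      (hct.tendsto y₀).eventually_lt_const h1, (hct.tendsto y₀).eventually_const_lt h0]
      with y hy hyW hycl hy1 hy2
    obtain ⟨hyt, hys, -⟩ := hy
    have hyt' := abs_sub_lt_iff.1 hyt
    refine Or.inr ⟨hyW, hy2, hy1, hycl, fun z hz => hthick ?_⟩
    rw [cthickening_closedBall hδ.le (by linarith)]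
    rw [mem_closedBall, dist_eq_norm]
    calc ‖z - E4.spatial (y₀ : E4)‖ ≤ ‖z - E4.spatial (y : E4)‖ + ‖E4.spatial (y : E4) - E4.spatial (y₀ : E4)‖ :=
          norm_sub_le_norm_sub_add_norm_sub _ _ _
      _ ≤ σ - t₀ + δ := by linarith
      _ = δ + (σ - t₀) := by ring

end Open

/-! ### Connectedness -/

section Connected

variable {M a : ℝ} {S : Set E3} {W : Set (Kerr.region a M)} {σ hp hm : ℝ}

/-- **The kite over a connected slice piece is connected** (`W` invariant under `+ u ∂_{t*}`, `u ≥ 0`):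
every point of the kite is joined to the point of `Σ = {σ} × S` below/above it by its vertical segment,
which stays in the kite, and `Σ ≅ S` is connected. [folklore] -/
theorem isConnected_kite (hhp : 0 < hp) (hSc : IsConnected S)
    (hSr : ∀ z ∈ S, E4.ofTimeSpace σ z ∈ Kerr.region a M)
    (hWup : ∀ y ∈ W, ∀ u : ℝ, 0 ≤ u →
      (⟨(y : E4) + u • E4.basisVector 0, Kerr.add_smul_basisVector_zero_mem_region y.2 u⟩ : Kerr.region a M) ∈ W) :
    IsConnected {y : Kerr.region a M |
      (σ ≤ (y : E4) 0 ∧ (y : E4) 0 < σ + hp ∧ ∀ z : E3, ‖z - E4.spatial (y : E4)‖ ≤ (y : E4) 0 - σ →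
        min (Kerr.radius a (y : E4)) (Kerr.rPlus M a) ≤ Kerr.radius a (E4.ofTimeSpace 0 z) → z ∈ S) ∨
      (y ∈ W ∧ σ - hm < (y : E4) 0 ∧ (y : E4) 0 < σ ∧
        σ + 2 / 3 * M < (y : E4) 0 + 2 / 3 * Kerr.radius a (y : E4) ∧
        ∀ z : E3, ‖z - E4.spatial (y : E4)‖ ≤ σ - (y : E4) 0 → z ∈ S)} := by
  classical
  set Kset := {y : Kerr.region a M |
      (σ ≤ (y : E4) 0 ∧ (y : E4) 0 < σ + hp ∧ ∀ z : E3, ‖z - E4.spatial (y : E4)‖ ≤ (y : E4) 0 - σ →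
        min (Kerr.radius a (y : E4)) (Kerr.rPlus M a) ≤ Kerr.radius a (E4.ofTimeSpace 0 z) → z ∈ S) ∨
      (y ∈ W ∧ σ - hm < (y : E4) 0 ∧ (y : E4) 0 < σ ∧
        σ + 2 / 3 * M < (y : E4) 0 + 2 / 3 * Kerr.radius a (y : E4) ∧
        ∀ z : E3, ‖z - E4.spatial (y : E4)‖ ≤ σ - (y : E4) 0 → z ∈ S)} with hKset
  -- the slice piece `Σ` as the image of `S`
  set emb : S → Kerr.region a M := fun z => ⟨E4.ofTimeSpace σ z.1, hSr z.1 z.2⟩ with hemb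
  have hembc : Continuous emb := ((E4.continuous_ofTimeSpace σ).comp continuous_subtype_val).subtype_mk _
  haveI : ConnectedSpace S := isConnected_iff_connectedSpace.1 hSc
  have hSlc : IsConnected (range emb) := isConnected_range hembc
  -- the point of the chart at level `t'` over the spatial point of `y`
  set pt : Kerr.region a M → ℝ → Kerr.region a M := fun y t' =>
    ⟨E4.ofTimeSpace t' (E4.spatial (y : E4)), ofTimeSpace_spatial_mem_region y t'⟩ with hpt
  have hpt0 : ∀ y t', ((pt y t' : Kerr.region a M) : E4) 0 = t' := fun y t' => rfl
  have hpts : ∀ y t', E4.spatial ((pt y t' : Kerr.region a M) : E4) = E4.spatial (y : E4) :=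
    fun y t' => E4.spatial_ofTimeSpace _ _
  have hptr : ∀ y t', Kerr.radius a ((pt y t' : Kerr.region a M) : E4) = Kerr.radius a (y : E4) :=
    fun y t' => Kerr.radius_eq_of_spatial_eq a (E4.spatial_ofTimeSpace _ _)
  have hptc : ∀ y, Continuous (pt y) := fun y =>
    (Continuous.subtype_mk (by
      show Continuous fun t' : ℝ => E4.ofTimeSpace t' (E4.spatial (y : E4))
      have : (fun t' : ℝ => E4.ofTimeSpace t' (E4.spatial (y : E4))) =
          fun t' => t' • E4.basisVector 0 + E4.ofTimeSpace 0 (E4.spatial (y : E4)) := by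
        funext t'; exact E4.ofTimeSpace_eq_smul_add t' _
      rw [this]; fun_prop) _)
  have hpt_self : ∀ y : Kerr.region a M, pt y ((y : E4) 0) = y := fun y =>
    Subtype.ext (by show E4.ofTimeSpace (E4.time (y : E4)) (E4.spatial (y : E4)) = y; exact E4.ofTimeSpace_time_spatial _)
  -- membership of the vertical segments
  have hup : ∀ y ∈ Kset, σ ≤ (y : E4) 0 → ∀ t' ∈ Icc σ ((y : E4) 0), pt y t' ∈ Kset := by
    intro y hy h0 t' ht'
    rcases hy with ⟨-, h1, hcone⟩ | ⟨-, -, h1, -⟩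
    · refine Or.inl ⟨by rw [hpt0]; exact ht'.1, by rw [hpt0]; linarith [ht'.2], fun z hz hrz => hcone z ?_ ?_⟩
      · rw [hpts, hpt0] at hz; linarith [ht'.2]
      · rwa [hptr] at hrz
    · exact absurd h1 (not_lt.2 h0)
  have hdn : ∀ y ∈ Kset, (y : E4) 0 < σ → ∀ t' ∈ Icc ((y : E4) 0) σ, pt y t' ∈ Kset := by
    intro y hy h0 t' ht'
    rcases hy with ⟨h1, -⟩ | ⟨hW, h1, -, hcl, hball⟩
    · exact absurd h1 (not_le.2 h0)
    rcases ht'.2.lt_or_eq with hlt | heq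
    · refine Or.inr ⟨?_, by rw [hpt0]; linarith [ht'.1], by rw [hpt0]; exact hlt, by rw [hpt0, hptr]; linarith [ht'.1],
        fun z hz => hball z ?_⟩
      · have h := hWup y hW (t' - (y : E4) 0) (sub_nonneg.2 ht'.1)
        convert h using 1
        refine Subtype.ext ?_
        show E4.ofTimeSpace t' (E4.spatial (y : E4)) = (y : E4) + (t' - (y : E4) 0) • E4.basisVector 0
        ext i
        refine Fin.cases ?_ (fun j => ?_) i
        · simp
        · simp [Fin.succ_ne_zero]
      · rw [hpts, hpt0] at hz; linarith [ht'.1]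
    · refine Or.inl ⟨by rw [hpt0, heq], by rw [hpt0, heq]; linarith, fun z hz _ => hball z ?_⟩
      rw [hpts, hpt0, heq, sub_self] at hz
      rw [norm_le_zero_iff.1 hz |> sub_eq_zero.1, sub_self, norm_zero]
      linarith [ht'.1]
  -- spatial parts of kite points lie in `S`
  have hspS : ∀ y ∈ Kset, E4.spatial (y : E4) ∈ S := by
    intro y hy
    rcases hy with ⟨h0, -, hcone⟩ | ⟨-, -, h1, -, hball⟩
    · exact hcone _ (by rw [sub_self, norm_zero]; linarith)
        (by rw [Kerr.radius_eq_of_spatial_eq a (E4.spatial_ofTimeSpace 0 _)]; exact min_le_left _ _)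
    · exact hball _ (by rw [sub_self, norm_zero]; linarith)
  -- the base point of `y` on `Σ`
  have hbase : ∀ y (hy : y ∈ Kset), pt y σ = emb ⟨E4.spatial (y : E4), hspS y hy⟩ := fun y hy => rfl
  obtain ⟨z₀, hz₀⟩ := hSc.nonempty
  have hrange : range emb ⊆ Kset := by
    rintro _ ⟨z, rfl⟩
    refine Or.inl ⟨le_rfl, by show σ < σ + hp; linarith, fun w hw _ => ?_⟩
    have hw' : ‖w - z.1‖ ≤ σ - σ := hw
    rw [sub_self] at hw'
    rw [norm_le_zero_iff.1 hw' |> sub_eq_zero.1]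
    exact z.2
  refine ⟨⟨emb ⟨z₀, hz₀⟩, hrange ⟨_, rfl⟩⟩, isPreconnected_of_forall (emb ⟨z₀, hz₀⟩) fun y hy => ?_⟩
  -- the vertical segment of `y` together with `Σ`
  rcases le_or_gt σ ((y : E4) 0) with h0 | h0
  · refine ⟨pt y '' Icc σ ((y : E4) 0) ∪ range emb, union_subset ?_ hrange, Or.inr ⟨_, rfl⟩,
      Or.inl ⟨(y : E4) 0, ⟨h0, le_rfl⟩, hpt_self y⟩, ?_⟩
    · rintro _ ⟨t', ht', rfl⟩; exact hup y hy h0 t' ht'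
    · refine IsPreconnected.union (pt y σ) ⟨σ, ⟨le_rfl, h0⟩, rfl⟩ ⟨⟨_, hspS y hy⟩, (hbase y hy).symm⟩
        ((isPreconnected_Icc.image _ (hptc y).continuousOn)) hSlc.isPreconnected
  · refine ⟨pt y '' Icc ((y : E4) 0) σ ∪ range emb, union_subset ?_ hrange, Or.inr ⟨_, rfl⟩,
      Or.inl ⟨(y : E4) 0, ⟨le_rfl, h0.le⟩, hpt_self y⟩, ?_⟩
    · rintro _ ⟨t', ht', rfl⟩; exact hdn y hy h0 t' ht'
    · refine IsPreconnected.union (pt y σ) ⟨σ, ⟨h0.le, le_rfl⟩, rfl⟩ ⟨⟨_, hspS y hy⟩, (hbase y hy).symm⟩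
        ((isPreconnected_Icc.image _ (hptc y).continuousOn)) hSlc.isPreconnected

end Connected

/-! ### Placement of the two halves of the kite -/

section Placement

variable [Kerr.Facts] {M a : ℝ} (hM0 : 0 < M) (ha : |a| < M) {S : Set E3} {W : Set (Kerr.region a M)}
  {σ hp hm : ℝ} (hhp : 0 < hp)
  (hW : ∀ x ∈ W, (Kerr.smoothMetric M a M).chronologicalFuture
    ((Kerr.timeOrientation M a M hM0.le).ofLE le_top) {x} ⊆ W)
  (U : Opens (Kerr.spacetime M a M hM0.le).carrier)
  (hU : ∀ y : Kerr.region a M, y ∈ U ↔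
    (σ ≤ (y : E4) 0 ∧ (y : E4) 0 < σ + hp ∧ ∀ z : E3, ‖z - E4.spatial (y : E4)‖ ≤ (y : E4) 0 - σ →
      min (Kerr.radius a (y : E4)) (Kerr.rPlus M a) ≤ Kerr.radius a (E4.ofTimeSpace 0 z) → z ∈ S) ∨
    (y ∈ W ∧ σ - hm < (y : E4) 0 ∧ (y : E4) 0 < σ ∧
      σ + 2 / 3 * M < (y : E4) 0 + 2 / 3 * Kerr.radius a (y : E4) ∧
      ∀ z : E3, ‖z - E4.spatial (y : E4)‖ ≤ σ - (y : E4) 0 → z ∈ S))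
include hhp hW hU ha

/-- **The upper kite lies in the chronological future of the level slice** (inside the kite):
`K ∩ {t* > σ} ⊆ I⁺_K({t* = σ})` — the endless timelike curve of `K` through a point
(`exists_isEndlessTimelikeCurve_through`) meets the slice exactly once, strictly before the point by the
clock `t*`. [cite: ONeill1983, Ch. 14, p. 415] -/
theorem upper_subset_chronologicalFuture_kite :
    (Subtype.val ⁻¹' {y : Kerr.region a M | σ < y.1 0} : Set U) ⊆
      ((Kerr.spacetime M a M hM0.le).metric.restrict PseudoRiemannianMetric.contMDiff_restrict_holds
        U).chronologicalFuture
      ((Kerr.spacetime M a M hM0.le).timeOrientation.restrict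
        PseudoRiemannianMetric.contMDiff_restrict_holds
        (Kerr.spacetime M a M hM0.le).timeOrientation.contMDiff_restrict_holds U)
      (Subtype.val ⁻¹' {y : Kerr.region a M | y.1 0 = σ}) := by
  intro z hz
  have hn2 : (2 : ℕ∞ω) ≤ ((⊤ : ℕ∞) : ℕ∞ω) := WithTop.coe_le_coe.mpr le_top
  obtain ⟨Δ, D, hΔ, h0D, hΔ0⟩ := LorentzianMetric.exists_isEndlessTimelikeCurve_through
    (g := (Kerr.spacetime M a M hM0.le).metric.restrict PseudoRiemannianMetric.contMDiff_restrict_holds U)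
    (τ := (Kerr.spacetime M a M hM0.le).timeOrientation.restrict
        PseudoRiemannianMetric.contMDiff_restrict_holds
        (Kerr.spacetime M a M hM0.le).timeOrientation.contMDiff_restrict_holds U) hn2 z
  obtain ⟨t₁, ⟨ht₁D, ht₁S⟩, -⟩ := isCauchyHypersurface_kite hM0 ha hhp hW U hU Δ D hΔ
  set γ' : ℝ → Kerr.region a M := Subtype.val ∘ Δ with hγ'
  have htl' : (Kerr.smoothMetric M a M).IsFutureTimelikeCurveOn
      ((Kerr.timeOrientation M a M hM0.le).ofLE le_top) γ' D :=
    (LorentzianMetric.isFutureTimelikeCurveOn_restrict_iff _ _ _ _ _).1 hΔ.2.1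
  have hmono := strictMonoOn_time' hΔ.1 htl'
  have hz0 : σ < z.1.1 0 := hz
  rcases lt_trichotomy t₁ 0 with ht | rfl | ht
  · exact ⟨Δ t₁, ht₁S, Δ, t₁, 0, ht, hΔ.2.1.mono (hΔ.1.out ht₁D h0D), rfl, hΔ0⟩
  · exfalso
    rw [hΔ0] at ht₁S
    have : z.1.1 0 = σ := ht₁S
    linarith
  · exfalso
    have h := hmono h0D ht₁D ht
    have h1 : (γ' t₁ : E4) 0 = σ := ht₁S
    have h0 : (γ' 0 : E4) 0 = z.1.1 0 := by
      have : γ' 0 = (z.1 : Kerr.region a M) := by rw [hγ', Function.comp_apply, hΔ0]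
      rw [this]
    simp only at h
    linarith

end Placement

end KerrKite

/-- **Registered bookkeeping sub-goal `stub_kerrKiteLevelPointMemRegion` of the line** (brick of the
landing of K2b-5 `stub_marchingLemma`): the point of the Kerr star chart at any level `t'` over the
spatial point of a chart point lies in the chart (the Kerr–Schild radius does not depend on `t*`) —
anchor of this file, whose content is the openness and connectedness of the kite
(`KerrKite.isOpen_kite`, `KerrKite.isConnected_kite`) and the placement of its halves
(`KerrKite.upper_subset_chronologicalFuture_kite`).
[folklore] -/
theorem stub_kerrKiteLevelPointMemRegion : ∀ (M a : ℝ) (y : Kerr.region a M) (t' : ℝ),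
    E4.ofTimeSpace t' (E4.spatial (y : E4)) ∈ Kerr.region a M :=
  fun _ _ y t' => KerrKite.ofTimeSpace_spatial_mem_region y t'

end Summit.FinalStateConjecture.FinalStateConjecture.Theorems.BondiBartnikRigidity.DirectMethod

end
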